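import Literature.AlgebraicGeometry.Motives.HodgeStructureLefschetzGroupCenterSigns
import Literature.AlgebraicGeometry.Motives.HodgeStructureRosatiInvolutionBlocks
import Literature.AlgebraicGeometry.Motives.HodgeStructureHodgeGroupCenter
import HarnessLib

/-!
# ANY TYPE: THE INVOLUTIONS IN THE CENTRE OF `S(A)(ℚ)` ARE EXACTLY THE `2^t` SIGN VECTORS ON THE SIMPLE FACTORS —
# `S₀(ℚ)[2] = U_{C₀}(ℚ)[2] = Π_k μ₂(K_k) = μ₂^t` FOR `C₀ = K₁ × ⋯ × K_t` (FIELDS OF ANY KIND), SO `#{γ ∈ Z(S(H)(ℚ)) | γ² = 1} = 2^t`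
# ALSO FOR TYPE IV (Milne 1999 §1 p. 645 `S₀(A) = U_{C₀}`; Moonen–Zarhin 1998 §1 Lemma (1))

[topic AlgebraicGeometry/Motives]

Layer `Literature/AlgebraicGeometry/Motives`, lane `lit-hodgefound` (Track 2 foundations library; prover seat
`lit-hodgefound-p02`, generation 55, self-proposed row g55-#6). THEOREMS ONLY: no definition, no named fact (net debt `0`),
no instance, no notation.  g54-#8 ∕ g55-#1 computed the centre of `S(H)(ℚ)` for `†` OF THE FIRST KIND: `Z(S(H)(ℚ)) ≅ μ₂^t`
through the signs on the `t` canonical blocks.  Milne's description `S₀(A)(R) = {γ ∈ C₀(A) ⊗ R | γ†γ = 1}` with `C₀(A)` «a product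
of fields, each of which is either a CM-field or `ℚ`. Every Rosati involution `†` preserves each factor» (p. 645) gives, for ANY
abelian variety, `S₀ = Π_k U_{K_k}` and hence `S₀(ℚ)[2] = Π_k {x ∈ K_k | x² = 1} = {±1}^t`: THE ELEMENTS OF ORDER `≤ 2` OF THE
CENTRE ARE THE SIGN VECTORS, WHATEVER THE TYPE (for a CM factor `U_K(ℚ)` is infinite but `U_K(ℚ)[2] = {±1}`).  Here, for a
polarized `ℚ`-Hodge structure `(H, ψ)` with NO hypothesis on `†`:
(i) a central `γ ∈ S(H)(ℚ)` WITH `γ² = 1` acts on every canonical block (and every irreducible sub-Hodge structure) by a sign —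
`↑γ = z ∈ Z(E_φ)` with `z² = 1`, and the coordinate of `z` in the FIELD `Z(E_φ(S))` is `±1`;
(ii) EVERY sign vector `(σ_S)` is realised by EXACTLY ONE central `γ`, and that `γ` is an involution — the unit `w ∈ C₀` with
chart `(σ_S)` is `†`-FIXED because `†` preserves each factor and fixes `±1` there (`(e w†)_k = ((e w)_k)^{†_k}`, the tree's
`Polarization.apply_adjointEndAlg_eq_adjointEndAlg`), so `w† w = w² = 1` and `w = ↑γ` (g54-#8 §1);
(iii) `#{γ ∈ Z(S(H)(ℚ)) | γ² = 1} = 2^t`, `t` = the number of canonical blocks — for `†` of the first kind every central `γ` is an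
involution (g54-#5) and this is g54-#8's `#Z(S(H)(ℚ)) = 2^t`; for type IV it counts the torsion `μ₂^t` inside the infinite centre;
(iv) a central element of `Hg(H)(ℚ)` of order `≤ 2` acts on every canonical block by a sign.

## The sources, verbatim

* J. S. Milne, *Lefschetz classes on abelian varieties*, Duke Math. J. 96 (1999) 639–675 [Milne1999LefschetzClasses] (held
  `paper:doi-10-1215-s0012-7094-99-09620-5`, folio 7): p. 645 L1–L6 "let `C₀(A)` be the centre of the `ℚ`-algebra `End⁰(A)` — it
  is a product of fields, each of which is either a CM-field or `ℚ`. Every Rosati involution `†` preserves each factor of `C₀(A)`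
  and acts on it as complex conjugation. Define `S₀(A)` to be the algebraic group over `ℚ` such that, for all commutative
  `ℚ`-algebras `R`, `S₀(A)(R) = {γ ∈ C₀(A) ⊗_ℚ R | γ†γ = 1}`"; Prop. 1.7 («`S₀(A)_{/ℚ_ℓ} → S_ℓ(A)` is an isomorphism» onto the
  centre part); Prop. 1.5 p. 644.
* B. J. J. Moonen, Yu. G. Zarhin, *Weil classes on abelian varieties*, J. reine angew. Math. 496 (1998) 83–92
  [MoonenZarhin1998WeilClasses] (held `paper:arxiv-alg-geom_9612017`, chunk p0002 L121–L127): «Lemma. (1) The center of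
  `G_div(X)` is the group `U_{K_B}` given by `U_{K_B}(R) = {a ∈ (K_B ⊗_ℚ R)^* ∣ a a† = 1}`. For `X` of type 4 with either `d ≥ 2`
  or `m ≥ 2` this is a connected torus of rank `e₀`; in all other cases it is finite.»
* H. Lange, *Abelian Varieties over the Complex Numbers* (2023) [Lange2023AbelianVarietiesComplex], §2.4.4 Cor. 2.4.26 (simple
  factors), §2.6.2 Lemma 2.6.4 ∕ 2.6.6 (`†` on the centre).

Nearest tree results, BY NAME: g55-#1 (`Motives/HodgeStructureLefschetzGroupCenterSigns`: the same statements UNDER `†` of the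
first kind; its `Polarization.eq_of_forall_exists_forall_apply_eq_smul` — central elements with equal signs are equal — is
kind-free and reused), g54-#8 `Polarization.exists_mem_center_lefschetzGroup_coe_eq`, g54-#4
`Polarization.mem_center_lefschetzGroup_iff_exists_mem_center`, the labelled decomposition (`exists_algEquiv_pi_endAlg_iSup'_fiber`,
`exists_ringEquiv_subringCenter_pi`, `existsUnique_iSup'_fiber_eq_of_minimal_stable`, `minimal_stable_iSup'_fiber`,
`existsUnique_minimal_stable_le`), `Polarization.apply_adjointEndAlg_eq_adjointEndAlg` (`†` block by block).

## Dictionary and what is proved (namespace `Literature.AlgebraicGeometry.Motives.HodgeStructure`)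

`S(H)(ℚ) = ψ.lefschetzGroup`, `Z(·) = Subgroup.center`, `Z(E_φ) = Subalgebra.center ℚ H.endAlg`, `†` = `ψ.adjoint`; a canonical
block = a minimal non-zero `E_φ`-stable `S : SubHodgeStructure H` (the tree's predicate, verbatim); `t` = their number.

* §1 **`Polarization.exists_forall_apply_eq_smul_iSup'_fiber_of_mul_self_eq_one`** (labelled),
  **`Polarization.exists_forall_apply_eq_smul_of_mul_self_eq_one`** (canonical blocks),
  **`Polarization.exists_forall_apply_eq_smul_of_mul_self_eq_one_of_isIrreducible`** (irreducible sub-Hodge structures).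
* §2 **`Polarization.existsUnique_mem_center_lefschetzGroup_forall_apply_eq_smul'`** (every sign vector, exactly once, any type),
  **`Polarization.mul_self_eq_one_of_forall_exists_forall_apply_eq_smul`** (a central `γ` acting by signs is an involution).
* §3 **`Polarization.natCard_center_lefschetzGroup_mul_self_eq_one`** (`#{γ ∈ Z | γ² = 1} = 2^t`, any type).
* §4 **`Polarization.exists_forall_apply_eq_smul_of_mem_center_hodgeGroup_of_mul_self_eq_one`** (central involutions of `Hg`).
-/

noncomputable section

namespace Literature.AlgebraicGeometry.Motives

namespace HodgeStructure

universe u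

variable {V : Type u} [AddCommGroup V] [Module ℚ V] [Module.Finite ℚ V] {n : ℤ} {H : HodgeStructure V n}

/-! ## §0 Elementary lemmas -/

omit [Module.Finite ℚ V] in
/-- In a commutative ring which is a field, `y² = 1 ⟹ y = ±1`, written as `y = ε` for a unit `ε ∈ ℤˣ`. [folklore] -/
private theorem exists_units_eq_intCast_of_mul_self_eq_one₅₅₆ {R : Type*} [CommRing R] (hR : IsField R) {y : R}
    (hy : y * y = 1) : ∃ ε : ℤˣ, y = ((ε : ℤ) : R) := by
  by_cases h : y - 1 = 0
  · exact ⟨1, by rw [Units.val_one, Int.cast_one]; exact sub_eq_zero.1 h⟩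
  · obtain ⟨w, hw⟩ := hR.mul_inv_cancel h
    refine ⟨-1, ?_⟩
    rw [Units.val_neg, Units.val_one, Int.cast_neg, Int.cast_one]
    refine eq_neg_of_add_eq_zero_left ?_
    calc y + 1 = (y - 1) * w * (y + 1) := by rw [hw, one_mul]
      _ = w * ((y - 1) * (y + 1)) := by ring
      _ = 0 := by rw [show (y - 1) * (y + 1) = 0 by linear_combination hy, mul_zero]

omit [Module.Finite ℚ V] in
/-- In a `ℚ`-vector space a non-zero vector distinguishes the signs. [folklore] -/
private theorem units_eq_of_smul_eq_smul₅₅₆ {v : V} (hv : v ≠ 0) {ε ε' : ℤˣ} (h : (ε : ℤ) • v = (ε' : ℤ) • v) :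
    ε = ε' := by
  have key : ∀ w : V, w = -w → w = 0 := fun w hw => by
    have h2 : (2 : ℚ) • w = 0 := by rw [two_smul]; nth_rewrite 2 [hw]; exact add_neg_cancel w
    exact (smul_eq_zero.1 h2).resolve_left two_ne_zero
  rcases Int.units_eq_one_or ε with rfl | rfl <;> rcases Int.units_eq_one_or ε' with rfl | rfl
  · rfl
  · rw [Units.val_one, one_zsmul, Units.val_neg, Units.val_one, neg_one_zsmul] at h
    exact absurd (key v h) hv
  · rw [Units.val_one, one_zsmul, Units.val_neg, Units.val_one, neg_one_zsmul] at h
    exact absurd (key v h.symm) hv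
  · rfl

omit [Module.Finite ℚ V] in
/-- The sign on a non-zero subspace is well defined. [folklore] -/
private theorem units_eq_of_forall_apply_eq_smul_of_ne_bot₅₅₆ {f : V → V} {S : Submodule ℚ V} (hS : S ≠ ⊥) {ε ε' : ℤˣ}
    (h : ∀ v ∈ S, f v = (ε : ℤ) • v) (h' : ∀ v ∈ S, f v = (ε' : ℤ) • v) : ε = ε' := by
  obtain ⟨v, hvS, hv⟩ := (Submodule.ne_bot_iff S).1 hS
  exact units_eq_of_smul_eq_smul₅₅₆ hv ((h v hvS).symm.trans (h' v hvS))

omit [Module.Finite ℚ V] in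
/-- An integer `m`, read in the centre `Z(E_φ(W))` and then as an endomorphism of `W ⊆ V`, acts as `v ↦ m • v`. [folklore] -/
private theorem coe_intCast_subringCenter_apply₅₅₆ (W : SubHodgeStructure H) (m : ℤ) (v : V) (hv : v ∈ W.toSubmodule) :
    (((((m : Subring.center W.toHodgeStructure.endAlg) : W.toHodgeStructure.endAlg) :
      Module.End ℚ W.toSubmodule) ⟨v, hv⟩ : W.toSubmodule) : V) = m • v := by
  rw [SubringClass.coe_intCast, SubringClass.coe_intCast, Module.End.intCast_apply, Submodule.coe_smul_of_tower]

omit [Module.Finite ℚ V] in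
/-- Sign vectors in a product of rings: along `ζ : Z ≃+* Π_k R_k`, every `σ : ι → ℤˣ` is the chart of a `w ∈ Z` with `w² = 1`. [folklore] -/
private theorem exists_mul_self_eq_one_forall_apply_eq₅₅₆ {Z : Type*} [CommRing Z] {ι : Type*} {R : ι → Type*}
    [∀ k, CommRing (R k)] (ζ : Z ≃+* Π k, R k) (σ : ι → ℤˣ) :
    ∃ w : Z, w * w = 1 ∧ ∀ k, ζ w k = ((σ k : ℤ) : R k) := by
  refine ⟨ζ.symm fun k => ((σ k : ℤ) : R k), ζ.injective ?_, fun k => by rw [ζ.apply_symm_apply]⟩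
  rw [ζ.map_mul, ζ.map_one, ζ.apply_symm_apply]
  funext k
  rw [Pi.mul_apply, Pi.one_apply, ← Int.cast_mul, ← Units.val_mul, Int.units_mul_self, Units.val_one, Int.cast_one]

omit [Module.Finite ℚ V] in
/-- An involution `†` of the endomorphism algebra of a sub-Hodge structure fixes the integers: `(m)^{†} = m`. [folklore] -/
private theorem adjointEndAlg_intCast₅₅₆ {W : Type u} [AddCommGroup W] [Module ℚ W] [Module.Finite ℚ W] {H' : HodgeStructure W n}
    (ψ' : Polarization H') (m : ℤ) : ψ'.adjointEndAlg (m : H'.endAlg) = m := by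
  have h1 : ψ'.adjointEndAlg (1 : H'.endAlg) = 1 :=
    Subtype.ext (by rw [Polarization.coe_adjointEndAlg_apply, OneMemClass.coe_one, Polarization.adjoint_one])
  rw [← zsmul_one m, map_zsmul, h1]

/-! ## §1 A central INVOLUTION of `S(H)(ℚ)` acts on each canonical block by a sign — any type -/

section Labelled

variable {ι : Type*} [Fintype ι] [DecidableEq ι] (T : ι → SubHodgeStructure H)
  (hT : DirectSum.IsInternal fun i => (T i).toSubmodule) {κ : Finset ι} {c : ι → κ}
  (hc : ∀ i, ∃ g : Hom (T i).toHodgeStructure (T (c i)).toHodgeStructure, Function.Bijective g.toLinearMap)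
  (hκ : ∀ k k' : κ, (∃ g : Hom (T k).toHodgeStructure (T k').toHodgeStructure,
    Function.Bijective g.toLinearMap) → k = k')

include hT hc hκ

set_option maxHeartbeats 400000 in
/-- **LABELLED FORM — A CENTRAL `γ ∈ S(H)(ℚ)` WITH `γ² = 1` ACTS ON EACH BLOCK `W_k = ⨆_{c i = k} Tᵢ` AS `±1`, FOR EVERY TYPE**:
`↑γ = z ∈ Z(E_φ)` (g54-#4) with `z² = 1`, and the `k`-th coordinate of `z` along `ζ : Z(E_φ) ≃+* Π_k Z(E_φ(W_k))` is a square root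
of `1` in the FIELD `Z(E_φ(W_k))`, i.e. `±1` — «`C₀(A)` is a product of fields», `U_{K_k}[2] = μ₂` for CM and totally real factors
alike. [cite: Milne1999LefschetzClasses, §1 p. 645 L1–L6 (C₀, S₀) and Prop. 1.5] [cite: MoonenZarhin1998WeilClasses, §1 Lemma (1)]
[cite: Lange2023AbelianVarietiesComplex, §2.4.4 Cor. 2.4.26] -/
theorem Polarization.exists_forall_apply_eq_smul_iSup'_fiber_of_mul_self_eq_one (ψ : Polarization H)
    (hirr : ∀ i, (T i).toHodgeStructure.IsIrreducible)
    {γ : ψ.lefschetzGroup} (hγ : γ ∈ Subgroup.center ψ.lefschetzGroup) (hγ2 : γ * γ = 1) (k : κ) :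
    ∃ ε : ℤˣ, ∀ v ∈ (SubHodgeStructure.iSup' fun x : {i // c i = k} => T x.1).toSubmodule,
      (γ : V ≃ₗ[ℚ] V) v = (ε : ℤ) • v := by
  classical
  obtain ⟨e, he⟩ := exists_algEquiv_pi_endAlg_iSup'_fiber T hT hc hκ hirr
  obtain ⟨ζ, hζ⟩ := exists_ringEquiv_subringCenter_pi
    (fun k : κ => SubHodgeStructure.iSup' fun x : {i // c i = k} => T x.1) e
  obtain ⟨z, hzc, hzγ⟩ := (ψ.mem_center_lefschetzGroup_iff_exists_mem_center γ).1 hγ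
  have hzc' : z ∈ Subring.center H.endAlg := Subring.mem_center_iff.2 (Subalgebra.mem_center_iff.1 hzc)
  -- `z² = 1` in `Z(E_φ)`, from `γ² = 1`
  have hγγ : ((γ : V ≃ₗ[ℚ] V) : Module.End ℚ V) * ((γ : V ≃ₗ[ℚ] V) : Module.End ℚ V) = 1 := by
    have h := congrArg (fun x : ψ.lefschetzGroup => ((x : V ≃ₗ[ℚ] V) : Module.End ℚ V)) hγ2
    simp only [Subgroup.coe_mul, Subgroup.coe_one, LinearEquiv.coe_toLinearMap_mul, LinearEquiv.coe_toLinearMap_one] at h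
    exact h
  have hzz : (⟨z, hzc'⟩ : Subring.center H.endAlg) * ⟨z, hzc'⟩ = 1 := by
    apply Subtype.ext
    apply Subtype.ext
    show ((z * z : H.endAlg) : Module.End ℚ V) = ((1 : H.endAlg) : Module.End ℚ V)
    rw [Subalgebra.coe_mul, Subalgebra.coe_one, hzγ]
    exact hγγ
  have hsq : ζ ⟨z, hzc'⟩ k * ζ ⟨z, hzc'⟩ k = 1 := by
    rw [← Pi.mul_apply, ← ζ.map_mul, hzz, ζ.map_one, Pi.one_apply]
  obtain ⟨ε, hε⟩ := exists_units_eq_intCast_of_mul_self_eq_one₅₅₆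
    (isField_subringCenter_endAlg_of_isSimpleRing _ (isSimpleRing_endAlg_iSup'_fiber T hT hc hκ hirr k)) hsq
  refine ⟨ε, fun v hv => ?_⟩
  have h1 := he z k ⟨v, hv⟩
  rw [Submodule.coe_mk] at h1
  have h2 : e z k = ((ζ ⟨z, hzc'⟩ k : Subring.center _) : _) := (hζ ⟨z, hzc'⟩ k).symm
  rw [← LinearEquiv.coe_coe, ← hzγ, ← h1, h2, hε]
  exact coe_intCast_subringCenter_apply₅₅₆ _ (ε : ℤ) v hv

end Labelled

/-- **A CENTRAL INVOLUTION OF `S(H)(ℚ)` ACTS ON EVERY CANONICAL BLOCK BY A SIGN, FOR EVERY TYPE**: for a central `γ ∈ S(H)(ℚ)` with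
`γ² = 1` and every minimal non-zero `E_φ`-stable sub-Hodge structure `S` there is `ε = ±1` with `γ v = ε v` on `S` — the
`S`-coordinate of `γ ∈ S₀(ℚ) ⊂ C₀ = Π_S K_S` satisfies `x² = 1` in the field `K_S` (`K_S` totally real OR CM).
[cite: Milne1999LefschetzClasses, §1 p. 645 L1–L6 and Prop. 1.5] [cite: MoonenZarhin1998WeilClasses, §1 Lemma (1)] [cite: Lange2023AbelianVarietiesComplex, §2.4.4 Cor. 2.4.26] -/
theorem Polarization.exists_forall_apply_eq_smul_of_mul_self_eq_one (ψ : Polarization H)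
    {γ : ψ.lefschetzGroup} (hγ : γ ∈ Subgroup.center ψ.lefschetzGroup) (hγ2 : γ * γ = 1) {S : SubHodgeStructure H}
    (hS : (∀ a ∈ H.endAlg, ∀ v ∈ S.toSubmodule, a v ∈ S.toSubmodule) ∧ S.toSubmodule ≠ ⊥ ∧
      ∀ S' : SubHodgeStructure H, (∀ a ∈ H.endAlg, ∀ v ∈ S'.toSubmodule, a v ∈ S'.toSubmodule) →
        S'.toSubmodule ≤ S.toSubmodule → S'.toSubmodule = ⊥ ∨ S'.toSubmodule = S.toSubmodule) :
    ∃ ε : ℤˣ, ∀ v ∈ S.toSubmodule, (γ : V ≃ₗ[ℚ] V) v = (ε : ℤ) • v := by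
  classical
  obtain ⟨s, _, κ, c, hT, hirr, hc, hκ⟩ := exists_isInternal_isIrreducible_labelling H ⟨ψ⟩
  have hirr' : ∀ x : s, (x : SubHodgeStructure H).toHodgeStructure.IsIrreducible := fun x => hirr x x.2
  obtain ⟨k, hk, -⟩ :=
    existsUnique_iSup'_fiber_eq_of_minimal_stable (fun S : s => (S : SubHodgeStructure H)) hT hc hκ hirr' hS
  obtain ⟨ε, hε⟩ := ψ.exists_forall_apply_eq_smul_iSup'_fiber_of_mul_self_eq_one
    (fun S : s => (S : SubHodgeStructure H)) hT hc hκ hirr' hγ hγ2 k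
  rw [hk] at hε
  exact ⟨ε, hε⟩

/-- **A CENTRAL INVOLUTION OF `S(H)(ℚ)` ACTS ON EVERY IRREDUCIBLE SUB-HODGE STRUCTURE BY A SIGN, FOR EVERY TYPE** (an irreducible
`U` lies in exactly one canonical block, `existsUnique_minimal_stable_le`). [cite: Milne1999LefschetzClasses, §1 p. 645 L1–L6 and Prop. 1.5]
[cite: Lange2023AbelianVarietiesComplex, §2.4.4 Cor. 2.4.26] -/
theorem Polarization.exists_forall_apply_eq_smul_of_mul_self_eq_one_of_isIrreducible (ψ : Polarization H)
    {γ : ψ.lefschetzGroup} (hγ : γ ∈ Subgroup.center ψ.lefschetzGroup) (hγ2 : γ * γ = 1) {U : SubHodgeStructure H}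
    (hU : U.toHodgeStructure.IsIrreducible) :
    ∃ ε : ℤˣ, ∀ v ∈ U.toSubmodule, (γ : V ≃ₗ[ℚ] V) v = (ε : ℤ) • v := by
  obtain ⟨S, ⟨hS, hUS⟩, -⟩ := existsUnique_minimal_stable_le ⟨ψ⟩ hU
  obtain ⟨ε, hε⟩ := ψ.exists_forall_apply_eq_smul_of_mul_self_eq_one hγ hγ2 hS
  exact ⟨ε, fun v hv => hε v (hUS hv)⟩

/-! ## §2 Every sign vector is realised by exactly one central element, which is an involution — any type -/

/-- **A CENTRAL `γ` ACTING BY SIGNS ON THE CANONICAL BLOCKS IS AN INVOLUTION**: if `γ|_S = ±1` for every canonical block `S` then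
`γ² = 1` (the blocks span `V`; `γ²|_S = (±1)² = 1`, and g55-#1 `eq_of_forall_exists_forall_apply_eq_smul`).
[cite: Milne1999LefschetzClasses, §1 p. 645 L1–L6 and Prop. 1.5] [cite: Lange2023AbelianVarietiesComplex, §2.4.4 Cor. 2.4.26] -/
theorem Polarization.mul_self_eq_one_of_forall_exists_forall_apply_eq_smul (ψ : Polarization H) {γ : ψ.lefschetzGroup}
    (h : ∀ S : SubHodgeStructure H, ((∀ a ∈ H.endAlg, ∀ v ∈ S.toSubmodule, a v ∈ S.toSubmodule) ∧ S.toSubmodule ≠ ⊥ ∧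
      ∀ S' : SubHodgeStructure H, (∀ a ∈ H.endAlg, ∀ v ∈ S'.toSubmodule, a v ∈ S'.toSubmodule) →
        S'.toSubmodule ≤ S.toSubmodule → S'.toSubmodule = ⊥ ∨ S'.toSubmodule = S.toSubmodule) →
      ∃ ε : ℤˣ, ∀ v ∈ S.toSubmodule, (γ : V ≃ₗ[ℚ] V) v = (ε : ℤ) • v) :
    γ * γ = 1 := by
  refine ψ.eq_of_forall_exists_forall_apply_eq_smul fun S hS => ?_
  obtain ⟨ε, hε⟩ := h S hS
  refine ⟨1, fun v hv => ?_, fun v _ => by rw [Units.val_one, one_zsmul]; rfl⟩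
  have hv' : (ε : ℤ) • v ∈ S.toSubmodule := Submodule.smul_of_tower_mem _ _ hv
  rw [Subgroup.coe_mul, LinearEquiv.mul_apply, hε v hv, hε _ hv', smul_smul, ← Units.val_mul, Int.units_mul_self]

/-- **EVERY SIGN VECTOR IS REALISED BY EXACTLY ONE CENTRAL ELEMENT OF `S(H)(ℚ)`, FOR EVERY TYPE**: for every `σ : SubHodgeStructure H
→ ℤˣ` (only its values on the canonical blocks matter) there is a unique central `γ` with `γ|_S = σ_S` on every canonical block `S`
— and that `γ` is an involution (`mul_self_eq_one_of_forall_exists_forall_apply_eq_smul`).  The unit `w ∈ C₀` with chart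
`(σ_S) ∈ Π_S Z(E_φ(S))` has `w² = 1` and is `†`-FIXED (the Rosati involution preserves each factor, `(e w†)_k = ((e w)_k)^{†_k}`,
and fixes the integers `±1` there), so `w† w = 1` and `w = ↑γ` for a central `γ` (g54-#8 §1); uniqueness by g55-#1
`eq_of_forall_exists_forall_apply_eq_smul`.  «`S₀ = U_{C₀}`, `U_{C₀}(ℚ) ⊇ μ₂^t`» for EVERY Albert type.
[cite: Milne1999LefschetzClasses, §1 p. 645 L1–L14 (C₀, S₀, Prop. 1.7) and Prop. 1.5] [cite: MoonenZarhin1998WeilClasses, §1 Lemma (1)]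
[cite: Lange2023AbelianVarietiesComplex, §2.4.4 Cor. 2.4.26 and §2.6.2 Lemma 2.6.4 ∕ 2.6.6] -/
theorem Polarization.existsUnique_mem_center_lefschetzGroup_forall_apply_eq_smul' (ψ : Polarization H)
    (σ : SubHodgeStructure H → ℤˣ) :
    ∃! γ : ψ.lefschetzGroup, γ ∈ Subgroup.center ψ.lefschetzGroup ∧
      ∀ S : SubHodgeStructure H, ((∀ a ∈ H.endAlg, ∀ v ∈ S.toSubmodule, a v ∈ S.toSubmodule) ∧ S.toSubmodule ≠ ⊥ ∧
        ∀ S' : SubHodgeStructure H, (∀ a ∈ H.endAlg, ∀ v ∈ S'.toSubmodule, a v ∈ S'.toSubmodule) →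
          S'.toSubmodule ≤ S.toSubmodule → S'.toSubmodule = ⊥ ∨ S'.toSubmodule = S.toSubmodule) →
        ∀ v ∈ S.toSubmodule, (γ : V ≃ₗ[ℚ] V) v = (σ S : ℤ) • v := by
  classical
  obtain ⟨s, _, κ, c, hT, hirr, hc, hκ⟩ := exists_isInternal_isIrreducible_labelling H ⟨ψ⟩
  have hirr' : ∀ x : s, (x : SubHodgeStructure H).toHodgeStructure.IsIrreducible := fun x => hirr x x.2
  obtain ⟨e, he⟩ := exists_algEquiv_pi_endAlg_iSup'_fiber (fun S : s => (S : SubHodgeStructure H)) hT hc hκ hirr'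
  obtain ⟨ζ, hζ⟩ := exists_ringEquiv_subringCenter_pi
    (fun k : κ => SubHodgeStructure.iSup' fun x : {i // c i = k} => ((x.1 : s) : SubHodgeStructure H)) e
  -- the central unit `w` whose chart is the prescribed sign vector on the blocks `W_k`
  obtain ⟨w, hww, hw⟩ := exists_mul_self_eq_one_forall_apply_eq₅₅₆
    (R := fun k : κ => Subring.center
      (SubHodgeStructure.iSup' fun x : {i // c i = k} => ((x.1 : s) : SubHodgeStructure H)).toHodgeStructure.endAlg)
    ζ fun k => σ (SubHodgeStructure.iSup' fun x : {i // c i = k} => ((x.1 : s) : SubHodgeStructure H))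
  have hwc : (w : H.endAlg) ∈ Subalgebra.center ℚ H.endAlg :=
    Subalgebra.mem_center_iff.2 (Subring.mem_center_iff.1 w.2)
  -- `(e w)_k` is the integer `σ_k`
  have hew : ∀ k : κ, e (w : H.endAlg) k =
      ((σ (SubHodgeStructure.iSup' fun x : {i // c i = k} => ((x.1 : s) : SubHodgeStructure H)) : ℤ) : _) := by
    intro k
    rw [← hζ w k, hw k, SubringClass.coe_intCast]
  -- `w` is `†`-fixed: `†` preserves each factor and fixes the integers there
  have hwfix : ψ.adjointEndAlg (w : H.endAlg) = w := by
    apply e.injective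
    funext k
    rw [ψ.apply_adjointEndAlg_eq_adjointEndAlg _ e he _ k, hew k, adjointEndAlg_intCast₅₅₆]
  have hunit : ψ.adjoint ((w : H.endAlg) : Module.End ℚ V) * ((w : H.endAlg) : Module.End ℚ V) = 1 := by
    rw [← Polarization.coe_adjointEndAlg_apply, hwfix, ← Subalgebra.coe_mul, ← Subring.coe_mul, hww, OneMemClass.coe_one,
      OneMemClass.coe_one]
  obtain ⟨γ, hγ, hγw⟩ := ψ.exists_mem_center_lefschetzGroup_coe_eq hwc hunit
  -- `γ` acts on `W_k` as the prescribed sign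
  have hγk : ∀ (k : κ) (v : V),
      v ∈ (SubHodgeStructure.iSup' fun x : {i // c i = k} => ((x.1 : s) : SubHodgeStructure H)).toSubmodule →
        (γ : V ≃ₗ[ℚ] V) v =
          (σ (SubHodgeStructure.iSup' fun x : {i // c i = k} => ((x.1 : s) : SubHodgeStructure H)) : ℤ) • v := by
    intro k v hv
    have h1 := he (w : H.endAlg) k ⟨v, hv⟩
    rw [Submodule.coe_mk] at h1
    rw [← LinearEquiv.coe_coe, hγw, ← h1, ← hζ w k, hw k]
    exact coe_intCast_subringCenter_apply₅₅₆ _ _ v hv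
  refine ⟨γ, ⟨hγ, fun S hS v hv => ?_⟩, ?_⟩
  · obtain ⟨k, hk, -⟩ :=
      existsUnique_iSup'_fiber_eq_of_minimal_stable (fun S : s => (S : SubHodgeStructure H)) hT hc hκ hirr' hS
    subst hk
    exact hγk k v hv
  · rintro γ' ⟨-, hγ'σ⟩
    refine ψ.eq_of_forall_exists_forall_apply_eq_smul fun S hS => ⟨σ S, hγ'σ S hS, fun v hv => ?_⟩
    obtain ⟨k, hk, -⟩ :=
      existsUnique_iSup'_fiber_eq_of_minimal_stable (fun S : s => (S : SubHodgeStructure H)) hT hc hκ hirr' hS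
    subst hk
    exact hγk k v hv

/-! ## §3 `#{γ ∈ Z(S(H)(ℚ)) | γ² = 1} = 2^t` — any type -/

/-- **THE CENTRE OF `S(A)(ℚ)` HAS EXACTLY `2^t` ELEMENTS OF ORDER `≤ 2`, FOR EVERY TYPE** (`t` = number of canonical blocks =
simple factors of `End⁰`): `γ ↦ (ε_S(γ))_S` is a bijection from the central involutions onto the sign vectors `{±1}^t` (well
defined by §1, injective by g55-#1 `eq_of_forall_exists_forall_apply_eq_smul`, surjective by §2) — `U_{C₀}(ℚ)[2] = Π_k μ₂(K_k)`.
For `†` of the first kind every central element is an involution (g54-#5) and this is g54-#8's `#Z(S(H)(ℚ)) = 2^t`; for type IV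
it is the `2`-torsion of the infinite centre. [cite: Milne1999LefschetzClasses, §1 p. 645 L1–L14 and §2 Summary p. 652]
[cite: MoonenZarhin1998WeilClasses, §1 Lemma (1)] [cite: Lange2023AbelianVarietiesComplex, §2.4.4 Cor. 2.4.26] -/
theorem Polarization.natCard_center_lefschetzGroup_mul_self_eq_one (ψ : Polarization H) :
    Nat.card {γ : Subgroup.center ψ.lefschetzGroup // γ * γ = 1} =
      2 ^ Nat.card {S : SubHodgeStructure H // (∀ a ∈ H.endAlg, ∀ v ∈ S.toSubmodule, a v ∈ S.toSubmodule) ∧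
        S.toSubmodule ≠ ⊥ ∧ ∀ S' : SubHodgeStructure H, (∀ a ∈ H.endAlg, ∀ v ∈ S'.toSubmodule, a v ∈ S'.toSubmodule) →
          S'.toSubmodule ≤ S.toSubmodule → S'.toSubmodule = ⊥ ∨ S'.toSubmodule = S.toSubmodule} := by
  classical
  haveI : Fintype {S : SubHodgeStructure H // (∀ a ∈ H.endAlg, ∀ v ∈ S.toSubmodule, a v ∈ S.toSubmodule) ∧ S.toSubmodule ≠ ⊥ ∧
      ∀ S' : SubHodgeStructure H, (∀ a ∈ H.endAlg, ∀ v ∈ S'.toSubmodule, a v ∈ S'.toSubmodule) →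
        S'.toSubmodule ≤ S.toSubmodule → S'.toSubmodule = ⊥ ∨ S'.toSubmodule = S.toSubmodule} :=
    ψ.finite_setOf_minimal_stable.fintype
  -- the sign of a central involution on a canonical block
  have hex := fun (γ : {γ : Subgroup.center ψ.lefschetzGroup // γ * γ = 1})
      (S : {S : SubHodgeStructure H // (∀ a ∈ H.endAlg, ∀ v ∈ S.toSubmodule, a v ∈ S.toSubmodule) ∧ S.toSubmodule ≠ ⊥ ∧
        ∀ S' : SubHodgeStructure H, (∀ a ∈ H.endAlg, ∀ v ∈ S'.toSubmodule, a v ∈ S'.toSubmodule) →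
          S'.toSubmodule ≤ S.toSubmodule → S'.toSubmodule = ⊥ ∨ S'.toSubmodule = S.toSubmodule}) =>
    ψ.exists_forall_apply_eq_smul_of_mul_self_eq_one γ.1.2 (congrArg Subtype.val γ.2) S.2
  choose ε hε using hex
  have hinj : Function.Injective ε := by
    intro γ γ' h
    apply Subtype.ext
    apply Subtype.ext
    exact ψ.eq_of_forall_exists_forall_apply_eq_smul fun S hS => ⟨ε γ ⟨S, hS⟩, hε γ ⟨S, hS⟩, h ▸ hε γ' ⟨S, hS⟩⟩
  have hsurj : Function.Surjective ε := by
    intro τ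
    obtain ⟨γ, ⟨hγ, hγσ⟩, -⟩ := ψ.existsUnique_mem_center_lefschetzGroup_forall_apply_eq_smul'
      fun S => if hS : _ then τ ⟨S, hS⟩ else 1
    have hγ2 : γ * γ = 1 := ψ.mul_self_eq_one_of_forall_exists_forall_apply_eq_smul fun S hS => ⟨_, hγσ S hS⟩
    refine ⟨⟨⟨γ, hγ⟩, Subtype.ext hγ2⟩, funext fun S => ?_⟩
    have h := hγσ S.1 S.2
    rw [dif_pos S.2] at h
    exact units_eq_of_forall_apply_eq_smul_of_ne_bot₅₅₆ S.2.2.1 (hε _ S) h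
  rw [Nat.card_congr (Equiv.ofBijective ε ⟨hinj, hsurj⟩), Nat.card_fun, Nat.card_eq_fintype_card (α := ℤˣ),
    Fintype.card_units_int, Nat.card_eq_fintype_card]

/-! ## §4 Central involutions of the Hodge group -/

section HodgeGroup

variable [HodgeTensorFacts.{u, u}]

/-- **A CENTRAL ELEMENT OF `Hg(H)(ℚ)` OF ORDER `≤ 2` ACTS ON EVERY CANONICAL BLOCK BY A SIGN, FOR EVERY TYPE** (it is a central
involution of `S(H)(ℚ)`, g54-#7 `Polarization.inclusion_mem_center_lefschetzGroup`). [cite: MoonenZarhin1998WeilClasses, §1 («Z(Hdg) ⊂ U_E»; Lemma (1))]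
[cite: Milne1999LefschetzClasses, §1 p. 645 L1–L14] -/
theorem Polarization.exists_forall_apply_eq_smul_of_mem_center_hodgeGroup_of_mul_self_eq_one (ψ : Polarization H)
    {γ : H.hodgeGroup} (hγ : γ ∈ Subgroup.center H.hodgeGroup) (hγ2 : γ * γ = 1) {S : SubHodgeStructure H}
    (hS : (∀ a ∈ H.endAlg, ∀ v ∈ S.toSubmodule, a v ∈ S.toSubmodule) ∧ S.toSubmodule ≠ ⊥ ∧
      ∀ S' : SubHodgeStructure H, (∀ a ∈ H.endAlg, ∀ v ∈ S'.toSubmodule, a v ∈ S'.toSubmodule) →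
        S'.toSubmodule ≤ S.toSubmodule → S'.toSubmodule = ⊥ ∨ S'.toSubmodule = S.toSubmodule) :
    ∃ ε : ℤˣ, ∀ v ∈ S.toSubmodule, (γ : V ≃ₗ[ℚ] V) v = (ε : ℤ) • v := by
  have h2 : Subgroup.inclusion ψ.hodgeGroup_le_lefschetzGroup γ * Subgroup.inclusion ψ.hodgeGroup_le_lefschetzGroup γ = 1 := by
    rw [← map_mul, hγ2, map_one]
  exact ψ.exists_forall_apply_eq_smul_of_mul_self_eq_one (ψ.inclusion_mem_center_lefschetzGroup hγ) h2 hS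

end HodgeGroup

end HodgeStructure

end Literature.AlgebraicGeometry.Motives
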